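import Mathlib
import Literature.NumberTheory.LFunctions.Zhang2022.Section2FunctionalEquation
import Literature.NumberTheory.LFunctions.Zhang2022.Section2AnalyticRootY
import Literature.NumberTheory.LFunctions.RiemannSiegelChiStirling
import HarnessLib

/-!
# Zhang (2022), §4 p. 8: `Z̃(s,ψ) = Z(s,ψ)Z(s,ψχ)`, the functional equation (4.4), the display
# "By (2.4) with `θ = ψ` and `θ = ψχ`", and the Stirling consequences (4.5)–(4.6), kernel-checked

Topic `Literature/NumberTheory/LFunctions/Zhang2022` (Landau–Siegel autopsy tree; verdict-neutral).
Y. Zhang, *Discrete mean estimates and the Landau–Siegel zero*, arXiv:2211.02515v1 (2022) — **an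
unrefereed manuscript, a claimed result under adjudication** (cell pub-zhang: audit + repair census
of arXiv:2211.02515; no claim about Landau–Siegel).

Glossary: the source macro `\l` is `𝓛 = log D` ((2.1)); `𝓛₁` is (2.8); `s₀ = 1/2 + 2πit₀`;
`P` is (2.6). Source text, §4 p. 8 [between (4.3) and Lemma 4.4]:

> Note that `χψ` is a primitive character (mod `Dp`). Write `Z̃(s,ψ) = Z(s,ψ)Z(s,ψχ)`, so that
> `L(s,ψ)L(s,ψχ) = Z̃(s,ψ)L(1−s,ψ̄)L(1−s,χψ̄)`.   (4.4)
> Recall that `s₀ = 1/2 + 2πit₀`. Assume that `|Re(s − s₀)| < 100`, `|Im(s − s₀)| < 𝓛₁ + 3`.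
> By (2.4) with `θ = ψ` and `θ = ψχ` we have
> `Z̃(s,ψ) = χ(−1)τ(ψ)τ(ψχ)(Dp²)^{−s}ϑ(s)²(1 + O(e^{−πt}))`.
> This yields, by Stirling's formula, `|Z̃(s,ψ)| = (Dp²t₀²)^{1/2−σ}(1 + o(1))`   (4.5)
> and `(Z̃′/Z̃)(s,ψ) = −2 log P + O(𝓛)`.   (4.6)

In this file `ψ` is a primitive character mod `k₁` and `θ₂` a primitive character mod `k₂` (the
manuscript: `k₁ = p`, `θ₂ = ψχ`, `k₂ = Dp`); `Z̃ := Z(·,ψ)Z(·,θ₂)` (`GammaFactor.tildeZ`). PROVED: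

* `GammaFactor.LFunction_mul_LFunction_eq` — **(4.4)** EXACT (from (2.2),
  `GammaFactor.LFunction_eq_Zfac_mul`, for Mathlib's `DirichletCharacter.LFunction`);
* `GammaFactor.tildeZ_eq` — the display, EXACT: `Z̃(s) = ψ(−1)θ₂(−1)·τ(ψ)τ(θ₂)·k₁^{−s}k₂^{−s}·
  ϑ(s)²·(1+r₁)(1+r₂)`, `rᵢ` the (2.4) corrections (`‖rᵢ‖ ≤ 3e^{−πt}`, `GammaFactor.norm_corr_le`);
  `GammaFactor.apply_neg_one_mul_eq` — the sign `ψ(−1)·(χ(−1)ψ(−1)) = χ(−1)`;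
* `GammaFactor.abs_norm_tildeZ_sub_le` — **(4.5) in exact form**: for `1 ≤ A`, `|σ| ≤ A`,
  `t ≥ 38(A+1)²`, `| |Z̃(σ+it)| − M | ≤ (570(A+1)²/t)·M` with `M = (k₁k₂(t/2π)²)^{1/2−σ}`
  (Stirling for `ϑ = χ`: the tree's `abs_norm_rsChi_sub_rpow_le`, Titchmarsh (4.12.3));
* `GammaFactor.norm_logDeriv_tildeZ_add_log_le` — **(4.6) in exact form**: for `1 ≤ A`,
  `0 < σ ≤ A`, `t ≥ 4A`, `‖(Z̃′/Z̃)(σ+it) + log(k₁t/2π) + log(k₂t/2π)‖ ≤ 2(4A+10)/t`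
  (from `GammaFactor.norm_logDeriv_Zfac_add_log_le` of `Section2AnalyticRootY`).

Scope notes. (4.5)/(4.6) AS PRINTED replace `(t/2π)²` by `t₀²` and `log(k₁k₂(t/2π)²)` by
`2 log P + O(𝓛)` under `|Im(s − s₀)| < 𝓛₁ + 3`, `p ≍ P`, `log t₀ ≪ log 𝓛` — parameter bookkeeping
((2.6)–(2.9)) that is not introduced here. The printed range `|Re(s − s₀)| < 100` includes `σ ≤ 0`;
(4.5) is proved here for all `|σ| ≤ A`, (4.6) only for `0 < σ ≤ A` (the case `σ ≤ 0` would follow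
from `ϑ(s)ϑ(1−s) = 1`, `GammaFactor.vartheta_mul_vartheta_one_sub`, and is not done here).
Nothing about Theorems 1–2 of the source is stated or implied; nothing here bears on the cell's
verdict on (8.24).

## References

* Y. Zhang, arXiv:2211.02515v1 (2022), §4 p. 8, (4.4)–(4.6). [cite: Zhang2022LandauSiegel, §4 (4.4)–(4.6)]
* E. C. Titchmarsh, *The Theory of the Riemann Zeta-Function*, 2nd ed. (1986), §4.12 (4.12.3)
  (Stirling for `χ(s)`; the tree's `RiemannSiegelChiStirling`). [cite: Titchmarsh1986, §4.12 (4.12.3)]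
-/

noncomputable section

open Complex Real

namespace Literature.NumberTheory.LFunctions.Zhang2022.GammaFactor

variable {k₁ k₂ : ℕ} [NeZero k₁] [NeZero k₂]

/-- `Z̃(s,ψ) = Z(s,ψ)Z(s,ψχ)`, with `θ₂` standing for the primitive character `ψχ` mod `Dp`.
[cite: Zhang2022LandauSiegel, §4 p. 8 (before (4.4))] -/
def tildeZ (ψ : DirichletCharacter ℂ k₁) (θ₂ : DirichletCharacter ℂ k₂) (s : ℂ) : ℂ :=
  Zfac ψ s * Zfac θ₂ s

/-- Unfolding lemma for `tildeZ`. [cite: Zhang2022LandauSiegel, §4 p. 8] -/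
lemma tildeZ_def (ψ : DirichletCharacter ℂ k₁) (θ₂ : DirichletCharacter ℂ k₂) (s : ℂ) :
    tildeZ ψ θ₂ s = Zfac ψ s * Zfac θ₂ s := rfl

/-- **(4.4)**, EXACT: `L(s,ψ)L(s,θ₂) = Z̃(s)·L(1−s,ψ̄)L(1−s,θ̄₂)` for primitive `ψ` mod `k₁ ≠ 1`,
primitive `θ₂` mod `k₂ ≠ 1`, `Im s ≠ 0` (Mathlib's `LFunction`; `ψ̄ = ψ⁻¹`).
[cite: Zhang2022LandauSiegel, §4 (4.4)] -/
theorem LFunction_mul_LFunction_eq {ψ : DirichletCharacter ℂ k₁} {θ₂ : DirichletCharacter ℂ k₂}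
    (hψ : ψ.IsPrimitive) (hk₁ : k₁ ≠ 1) (hθ : θ₂.IsPrimitive) (hk₂ : k₂ ≠ 1) {s : ℂ}
    (hs : s.im ≠ 0) :
    ψ.LFunction s * θ₂.LFunction s
      = tildeZ ψ θ₂ s * (ψ⁻¹.LFunction (1 - s) * θ₂⁻¹.LFunction (1 - s)) := by
  rw [LFunction_eq_Zfac_mul hψ hk₁ hs, LFunction_eq_Zfac_mul hθ hk₂ hs, tildeZ_def]
  ring

/-- **"By (2.4) with `θ = ψ` and `θ = ψχ`"**, EXACT: for `Im s > 0`,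
`Z̃(s) = ψ(−1)θ₂(−1)·τ(ψ)τ(θ₂)·k₁^{−s}k₂^{−s}·ϑ(s)²·(1+r₁)(1+r₂)` with `rᵢ = corr` of (2.4)
(`‖rᵢ‖ ≤ 3e^{−πt}` for `t ≥ 1`, `GammaFactor.norm_corr_le`; the source's `(Dp²)^{−s} = p^{−s}(Dp)^{−s}`).
[cite: Zhang2022LandauSiegel, §4 p. 8 (display after (4.4))] -/
theorem tildeZ_eq (ψ : DirichletCharacter ℂ k₁) (θ₂ : DirichletCharacter ℂ k₂) {s : ℂ}
    (hs : 0 < s.im) :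
    tildeZ ψ θ₂ s = (ψ (-1) * θ₂ (-1)) * (tau ψ * tau θ₂) * ((k₁ : ℂ) ^ (-s) * (k₂ : ℂ) ^ (-s))
      * vartheta s ^ 2 * ((1 + corr ψ s) * (1 + corr θ₂ s)) := by
  rw [tildeZ_def, Zfac_eq ψ hs, Zfac_eq θ₂ hs]
  ring

omit [NeZero k₁] in
/-- The sign of the display: if `θ₂(−1) = χ(−1)ψ(−1)` (as for `θ₂ = ψχ`) then
`ψ(−1)θ₂(−1) = χ(−1)`, since `ψ(−1)² = 1`. [cite: Zhang2022LandauSiegel, §4 p. 8] -/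
theorem apply_neg_one_mul_eq (ψ : DirichletCharacter ℂ k₁) {ε₂ εχ : ℂ} (h : ε₂ = εχ * ψ (-1)) :
    ψ (-1) * ε₂ = εχ := by
  have hsq : ψ (-1) * ψ (-1) = 1 := by rw [← map_mul, neg_mul_neg, one_mul, map_one]
  rw [h]
  linear_combination εχ * hsq

/-! ## (4.5): `|Z̃(σ+it)| = (k₁k₂(t/2π)²)^{1/2−σ}(1 + O_A(1/t))` -/

omit [NeZero k₁] in
/-- `|θ(−1)| = 1`. [folklore] -/
theorem norm_apply_neg_one (θ : DirichletCharacter ℂ k₁) : ‖θ (-1)‖ = 1 := by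
  have hsq : θ (-1) * θ (-1) = 1 := by rw [← map_mul, neg_mul_neg, one_mul, map_one]
  have h := congrArg (fun z : ℂ => ‖z‖) hsq
  simp only [norm_mul, norm_one] at h
  nlinarith [norm_nonneg (θ (-1))]

/-- `|τ(θ)| = √k` for primitive `θ` mod `k`. [cite: MontgomeryVaughan2007, Thm 9.7] -/
theorem norm_tau {θ : DirichletCharacter ℂ k₁} (hθ : θ.IsPrimitive) :
    ‖tau θ‖ = Real.sqrt k₁ := by
  rw [← Real.sqrt_sq (norm_nonneg (tau θ)), tau,
    Literature.NumberTheory.Sieve.LargeSieve.norm_gaussSum_sq hθ]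

/-- `|k^{−(σ+it)}| = k^{−σ}`. [folklore] -/
theorem norm_natCast_cpow_neg (σ t : ℝ) :
    ‖(k₁ : ℂ) ^ (-((σ : ℂ) + t * I))‖ = (k₁ : ℝ) ^ (-σ) := by
  rw [Complex.norm_natCast_cpow_of_pos (Nat.pos_of_ne_zero (NeZero.ne k₁))]
  simp

/-- `√k·k^{−σ} = k^{1/2−σ}`. [folklore] -/
theorem sqrt_mul_rpow_neg (σ : ℝ) :
    Real.sqrt k₁ * (k₁ : ℝ) ^ (-σ) = (k₁ : ℝ) ^ (1 / 2 - σ) := by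
  have hk : (0 : ℝ) < k₁ := Nat.cast_pos.mpr (Nat.pos_of_ne_zero (NeZero.ne k₁))
  rw [sub_eq_add_neg, Real.rpow_add hk, Real.sqrt_eq_rpow]

omit [NeZero k₁] in
/-- `|‖1 + r‖ − 1| ≤ 1/t` for the (2.4) correction `r` when `t ≥ 1` (`‖r‖ ≤ 3e^{−πt} ≤ 3/(πt)`).
[cite: Zhang2022LandauSiegel, §2 (2.4)] -/
theorem abs_norm_one_add_corr_sub_one_le (θ : DirichletCharacter ℂ k₁) {σ t : ℝ} (ht : 1 ≤ t) :
    |‖1 + corr θ ((σ : ℂ) + t * I)‖ - 1| ≤ 1 / t := by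
  have ht0 : 0 < t := by linarith
  have him : ((σ : ℂ) + t * I).im = t := by simp
  have h1 : ‖corr θ ((σ : ℂ) + t * I)‖ ≤ 3 * Real.exp (-π * t) := by
    have := norm_corr_le θ (s := (σ : ℂ) + t * I) (by rw [him]; exact ht)
    rwa [him] at this
  have h2 : Real.exp (-π * t) ≤ 1 / (π * t) := by
    have := ChiStirling.exp_neg_pi_mul_le ht0
    rwa [show -(π * t) = -π * t by ring] at this
  have h3 : 3 * (1 / (π * t)) ≤ 1 / t := by
    rw [mul_one_div, div_le_div_iff₀ (by positivity) ht0]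
    nlinarith [Real.pi_gt_three]
  have h4 : |‖1 + corr θ ((σ : ℂ) + t * I)‖ - 1| ≤ ‖corr θ ((σ : ℂ) + t * I)‖ := by
    have := abs_norm_sub_norm_le (1 + corr θ ((σ : ℂ) + t * I)) (1 : ℂ)
    simpa using this
  linarith

/-- Elementary: if `a, b, c ∈ [1 − e, 1 + e]` with `0 ≤ e ≤ 1` then `|a²bc − 1| ≤ 15e`. [folklore] -/
theorem abs_sq_mul_mul_sub_one_le {a b c e : ℝ} (he0 : 0 ≤ e) (he1 : e ≤ 1)
    (ha : |a - 1| ≤ e) (hb : |b - 1| ≤ e) (hc : |c - 1| ≤ e) :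
    |a ^ 2 * b * c - 1| ≤ 15 * e := by
  obtain ⟨ha1, ha2⟩ := abs_le.mp ha
  obtain ⟨hb1, hb2⟩ := abs_le.mp hb
  obtain ⟨hc1, hc2⟩ := abs_le.mp hc
  have ha0 : 0 ≤ a := by linarith
  have hb0 : 0 ≤ b := by linarith
  have hc0 : 0 ≤ c := by linarith
  have hl : 0 ≤ 1 - e := by linarith
  have hup : a ^ 2 * b * c ≤ (1 + e) ^ 4 := by
    have h1 : a ^ 2 ≤ (1 + e) ^ 2 := pow_le_pow_left₀ ha0 (by linarith) 2
    have h2 : b * c ≤ (1 + e) * (1 + e) := mul_le_mul (by linarith) (by linarith) hc0 (by linarith)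
    calc a ^ 2 * b * c = a ^ 2 * (b * c) := by ring
      _ ≤ (1 + e) ^ 2 * ((1 + e) * (1 + e)) :=
          mul_le_mul h1 h2 (mul_nonneg hb0 hc0) (by positivity)
      _ = (1 + e) ^ 4 := by ring
  have hlo : (1 - e) ^ 4 ≤ a ^ 2 * b * c := by
    have h1 : (1 - e) ^ 2 ≤ a ^ 2 := pow_le_pow_left₀ hl (by linarith) 2
    have h2 : (1 - e) * (1 - e) ≤ b * c := mul_le_mul (by linarith) (by linarith) hl hb0
    calc (1 - e) ^ 4 = (1 - e) ^ 2 * ((1 - e) * (1 - e)) := by ring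
      _ ≤ a ^ 2 * (b * c) := mul_le_mul h1 h2 (mul_nonneg hl hl) (sq_nonneg a)
      _ = a ^ 2 * b * c := by ring
  have he2 : e * e ≤ e := by nlinarith
  have he3 : e * e * e ≤ e := by nlinarith
  have he4 : e * e * (e * e) ≤ e := by nlinarith
  have hup' : (1 + e) ^ 4 ≤ 1 + 15 * e := by
    have : (1 + e) ^ 4 = 1 + 4 * e + 6 * (e * e) + 4 * (e * e * e) + e * e * (e * e) := by ring
    rw [this]; linarith
  have hlo' : 1 - 15 * e ≤ (1 - e) ^ 4 := by
    have : (1 - e) ^ 4 = 1 - 4 * e + 6 * (e * e) - 4 * (e * e * e) + e * e * (e * e) := by ring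
    rw [this]; nlinarith [mul_nonneg he0 he0, mul_nonneg (mul_nonneg he0 he0) (mul_nonneg he0 he0)]
  rw [abs_le]
  constructor <;> linarith

/-- **(4.5) in exact form**: for primitive `ψ` mod `k₁`, primitive `θ₂` mod `k₂`, `1 ≤ A`,
`|σ| ≤ A`, `t ≥ 38(A+1)²`: `| |Z̃(σ+it)| − M | ≤ (570(A+1)²/t)·M`, `M = (k₁k₂(t/2π)²)^{1/2−σ}`
(the source: "`|Z̃(s,ψ)| = (Dp²t₀²)^{1/2−σ}(1 + o(1))`", with `(t/2π)²` in place of `t₀²`).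
[cite: Zhang2022LandauSiegel, §4 (4.5)] [cite: Titchmarsh1986, §4.12 (4.12.3)] -/
theorem abs_norm_tildeZ_sub_le {ψ : DirichletCharacter ℂ k₁} {θ₂ : DirichletCharacter ℂ k₂}
    (hψ : ψ.IsPrimitive) (hθ : θ₂.IsPrimitive) {A σ t : ℝ} (hA : 1 ≤ A) (hσA : |σ| ≤ A)
    (ht : 38 * (A + 1) ^ 2 ≤ t) :
    |‖tildeZ ψ θ₂ (σ + t * I)‖ - ((k₁ : ℝ) * k₂ * (t / (2 * π)) ^ 2) ^ (1 / 2 - σ)|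
      ≤ 570 * (A + 1) ^ 2 / t * ((k₁ : ℝ) * k₂ * (t / (2 * π)) ^ 2) ^ (1 / 2 - σ) := by
  -- positivity bookkeeping
  have hA1 : 1 ≤ (A + 1) ^ 2 := one_le_pow₀ (by linarith)
  have ht1 : 1 ≤ t := by nlinarith
  have ht0 : 0 < t := by linarith
  have hk1 : (0 : ℝ) < k₁ := Nat.cast_pos.mpr (Nat.pos_of_ne_zero (NeZero.ne k₁))
  have hk2 : (0 : ℝ) < k₂ := Nat.cast_pos.mpr (Nat.pos_of_ne_zero (NeZero.ne k₂))
  have him : ((σ : ℂ) + t * I).im = t := by simp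
  have hs : 0 < ((σ : ℂ) + t * I).im := by rw [him]; exact ht0
  set e : ℝ := 38 * (A + 1) ^ 2 / t with he_def
  have he0 : 0 ≤ e := by positivity
  have he1 : e ≤ 1 := by rw [he_def, div_le_one ht0]; exact ht
  have het : 1 / t ≤ e := by rw [he_def]; gcongr; linarith
  set R : ℝ := (t / (2 * π)) ^ (1 / 2 - σ) with hR_def
  have hR : 0 < R := Real.rpow_pos_of_pos (by positivity) _
  -- the main term `M = k₁^{1/2−σ} k₂^{1/2−σ} R²`
  set M : ℝ := ((k₁ : ℝ) * k₂ * (t / (2 * π)) ^ 2) ^ (1 / 2 - σ) with hM_def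
  have hM : M = (k₁ : ℝ) ^ (1 / 2 - σ) * (k₂ : ℝ) ^ (1 / 2 - σ) * R ^ 2 := by
    rw [hM_def, Real.mul_rpow (by positivity) (by positivity), Real.mul_rpow hk1.le hk2.le, hR_def,
      ← Real.rpow_natCast ((t / (2 * π)) ^ (1 / 2 - σ)) 2, ← Real.rpow_mul (by positivity),
      mul_comm (1 / 2 - σ) ((2 : ℕ) : ℝ), Real.rpow_mul (by positivity), Real.rpow_natCast]
  have hM0 : 0 < M := by rw [hM_def]; exact Real.rpow_pos_of_pos (by positivity) _
  -- the factors of `‖Z̃‖`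
  have hϑ : |‖vartheta ((σ : ℂ) + t * I)‖ - R| ≤ e * R := by
    rw [vartheta_eq_rsChi (by rw [him]; exact ht0.ne'), hR_def, he_def]
    exact abs_norm_rsChi_sub_rpow_le hA hσA ht
  have hr1 := abs_norm_one_add_corr_sub_one_le ψ (σ := σ) ht1
  have hr2 := abs_norm_one_add_corr_sub_one_le θ₂ (σ := σ) ht1
  -- `‖Z̃‖ = M · (a² b c)` with `a = ‖ϑ‖/R`, `b, c = ‖1 + rᵢ‖`
  set a : ℝ := ‖vartheta ((σ : ℂ) + t * I)‖ / R with ha_def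
  set b : ℝ := ‖1 + corr ψ ((σ : ℂ) + t * I)‖ with hb_def
  set c : ℝ := ‖1 + corr θ₂ ((σ : ℂ) + t * I)‖ with hc_def
  have hnorm : ‖tildeZ ψ θ₂ (σ + t * I)‖ = M * (a ^ 2 * b * c) := by
    rw [tildeZ_eq ψ θ₂ hs]
    simp only [norm_mul, norm_pow]
    rw [norm_apply_neg_one, norm_apply_neg_one, norm_tau hψ, norm_tau hθ, norm_natCast_cpow_neg,
      norm_natCast_cpow_neg, hM, ← sqrt_mul_rpow_neg (k₁ := k₁) σ, ← sqrt_mul_rpow_neg (k₁ := k₂) σ,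
      ha_def, hb_def, hc_def]
    field_simp
  have ha : |a - 1| ≤ e := by
    rw [ha_def]
    have : |‖vartheta ((σ : ℂ) + t * I)‖ / R - 1| = |‖vartheta ((σ : ℂ) + t * I)‖ - R| / R := by
      rw [show ‖vartheta ((σ : ℂ) + t * I)‖ / R - 1 = (‖vartheta ((σ : ℂ) + t * I)‖ - R) / R by
        field_simp, abs_div, abs_of_pos hR]
    rw [this, div_le_iff₀ hR]
    exact hϑ
  have hb : |b - 1| ≤ e := hr1.trans het
  have hc : |c - 1| ≤ e := hr2.trans het
  have key := abs_sq_mul_mul_sub_one_le he0 he1 ha hb hc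
  rw [hnorm, show M * (a ^ 2 * b * c) - M = M * (a ^ 2 * b * c - 1) by ring, abs_mul,
    abs_of_pos hM0]
  calc M * |a ^ 2 * b * c - 1| ≤ M * (15 * e) := by gcongr
    _ = 570 * (A + 1) ^ 2 / t * M := by rw [he_def]; ring

/-! ## (4.6): `(Z̃′/Z̃)(σ+it) = −log(k₁t/2π) − log(k₂t/2π) + O_A(1/t)` -/

/-- **(4.6) in exact form**: for primitive `ψ` mod `k₁`, primitive `θ₂` mod `k₂`, `1 ≤ A`,
`0 < σ ≤ A`, `t ≥ 4A`: `‖(Z̃′/Z̃)(σ+it) + log(k₁t/2π) + log(k₂t/2π)‖ ≤ 2(4A+10)/t`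
(the source: "`= −2 log P + O(𝓛)`"). [cite: Zhang2022LandauSiegel, §4 (4.6)] -/
theorem norm_logDeriv_tildeZ_add_log_le {ψ : DirichletCharacter ℂ k₁} {θ₂ : DirichletCharacter ℂ k₂}
    (hψ : ψ.IsPrimitive) (hθ : θ₂.IsPrimitive) {A σ t : ℝ} (hA : 1 ≤ A) (hσ0 : 0 < σ)
    (hσA : σ ≤ A) (ht : 4 * A ≤ t) :
    ‖logDeriv (tildeZ ψ θ₂) (σ + t * I)
        + (((Real.log ((k₁ : ℝ) * t / (2 * π)) : ℝ) : ℂ) + ((Real.log ((k₂ : ℝ) * t / (2 * π)) : ℝ) : ℂ))‖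
      ≤ 2 * ((4 * A + 10) / t) := by
  have ht0 : 0 < t := by linarith
  have him : ((σ : ℂ) + t * I).im = t := by simp
  have hs : 0 < ((σ : ℂ) + t * I).im := by rw [him]; exact ht0
  have h1 := norm_logDeriv_Zfac_add_log_le hψ hA hσ0 hσA ht (y := 0) (by rw [abs_zero]; positivity)
  have h2 := norm_logDeriv_Zfac_add_log_le hθ hA hσ0 hσA ht (y := 0) (by rw [abs_zero]; positivity)
  simp only [ofReal_zero, zero_mul, add_zero, abs_zero, mul_zero, zero_add] at h1 h2
  have hmul : logDeriv (tildeZ ψ θ₂) ((σ : ℂ) + t * I)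
      = logDeriv (Zfac ψ) ((σ : ℂ) + t * I) + logDeriv (Zfac θ₂) ((σ : ℂ) + t * I) := by
    have hfun : tildeZ ψ θ₂ = fun s => Zfac ψ s * Zfac θ₂ s := rfl
    rw [hfun]
    exact logDeriv_mul ((σ : ℂ) + t * I) (Zfac_ne_zero hψ hs) (Zfac_ne_zero hθ hs)
      (analyticAt_Zfac ψ hs).differentiableAt (analyticAt_Zfac θ₂ hs).differentiableAt
  rw [hmul]
  calc ‖logDeriv (Zfac ψ) ((σ : ℂ) + t * I) + logDeriv (Zfac θ₂) ((σ : ℂ) + t * I)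
        + (((Real.log ((k₁ : ℝ) * t / (2 * π)) : ℝ) : ℂ) + ((Real.log ((k₂ : ℝ) * t / (2 * π)) : ℝ) : ℂ))‖
      = ‖(logDeriv (Zfac ψ) ((σ : ℂ) + t * I) + ((Real.log ((k₁ : ℝ) * t / (2 * π)) : ℝ) : ℂ))
        + (logDeriv (Zfac θ₂) ((σ : ℂ) + t * I) + ((Real.log ((k₂ : ℝ) * t / (2 * π)) : ℝ) : ℂ))‖ := by
          ring_nf
    _ ≤ ‖logDeriv (Zfac ψ) ((σ : ℂ) + t * I) + ((Real.log ((k₁ : ℝ) * t / (2 * π)) : ℝ) : ℂ)‖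
        + ‖logDeriv (Zfac θ₂) ((σ : ℂ) + t * I) + ((Real.log ((k₂ : ℝ) * t / (2 * π)) : ℝ) : ℂ)‖ :=
          norm_add_le _ _
    _ ≤ (4 * A + 10) / t + (4 * A + 10) / t := add_le_add h1 h2
    _ = 2 * ((4 * A + 10) / t) := by ring

/-- The two logarithms of (4.6) combined: `log(k₁t/2π) + log(k₂t/2π) = log(k₁k₂(t/2π)²)` (`t > 0`).
[folklore] -/
theorem log_add_log_eq {t : ℝ} (ht : 0 < t) :
    Real.log ((k₁ : ℝ) * t / (2 * π)) + Real.log ((k₂ : ℝ) * t / (2 * π))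
      = Real.log ((k₁ : ℝ) * k₂ * (t / (2 * π)) ^ 2) := by
  have hk1 : (0 : ℝ) < k₁ := Nat.cast_pos.mpr (Nat.pos_of_ne_zero (NeZero.ne k₁))
  have hk2 : (0 : ℝ) < k₂ := Nat.cast_pos.mpr (Nat.pos_of_ne_zero (NeZero.ne k₂))
  rw [← Real.log_mul (by positivity) (by positivity)]
  congr 1
  ring

end Literature.NumberTheory.LFunctions.Zhang2022.GammaFactor
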